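import Literature.NumberTheory.Automorphic.UnitaryThreeBoundaryRigidityLevelTwo     -- ★ RIGID-2 `levelTwo_conj_cornerUnipotent_of_two_deep`, `levelTwo_conj_upperUnipotent_one_of_two_deep`, §4 adapter
import Literature.NumberTheory.Automorphic.UnitaryThreeSingularUnipotentClasses      -- ★ `exists_units_coe_eq_cornerUnipotent`, `mem_unitaryGroupOfForm_iff_of_coe_eq_cornerUnipotent`
import Literature.NumberTheory.Automorphic.UnitaryThreeRegularUnipotentClass         -- ★ `exists_units_coe_eq_upperTriangularUnipotent`, `mem_unitaryGroupOfForm_iff_of_coe_eq_upperUnipotent`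
import Literature.NumberTheory.Automorphic.UnitaryThreeLevelTwoCongruence           -- ★ `isIntMatrix_upperUnipotent`
import HarnessLib

/-!
# RIGID-2 in unit-factor form (Rogawski 1990 §3.9, Tits 1979 §3.5)

Over a non-archimedean local field `K` with involution `σ` and unramified datum `(σ, ϖ)`, `U = U(σ, J₀)` the quasi-split unitary
group in three variables, `K₀ = U ∩ GL₃(𝒪)` hyperspecial: the tree's boundary rigidity ★ `levelTwo_conj_cornerUnipotent_of_two_deep`
∕ ★ `levelTwo_conj_upperUnipotent_one_of_two_deep` says that an integral `x = g⁻¹γg` with `γ ≡ 1 (ϖ²)` and `x` residually a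
transvection (resp. residually regular unipotent) is `K₀`-conjugate to an element `≡ n(t₀)` (resp. `≡ u(1,b₀)`) modulo `ϖ²`.
Here the congruence is repackaged as a FACTORISATION `k x k⁻¹ = u · n(t₀)` (resp. `u · u(1,b₀)`) with a unit factor `u ∈ U`,
`u ≡ 1 (ϖ²)` (★ §4 adapter `isIntMatrix_smul_mul_inv_sub_one`) — the form consumed by functions on `U` that are left-invariant
under the level-2 congruence subgroup.

**Main results.** `exists_conj_eq_levelTwo_mul_cornerUnipotent_of_two_deep`, `exists_conj_eq_levelTwo_mul_upperUnipotent_one_of_two_deep`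
(and the bookkeeping `isIntMatrix_upperUnipotent`).

## References
* [Rogawski1990] J. D. Rogawski, *Automorphic Representations of Unitary Groups in Three Variables*, Ann. of Math. Stud. 123 (1990): §3.9 p. 32, Prop. 3.9.1.
* [Tits1979] J. Tits, *Reductive groups over local fields*, Proc. Sympos. Pure Math. 33.1 (1979): §3.3.3, §3.5 (congruence filtration of hyperspecial `K₀`).
-/

set_option autoImplicit false

noncomputable section

open Matrix
open scoped Valued WithZero Matrix MatrixGroups

namespace Literature.NumberTheory.Automorphic.UnitaryGroup


open Literature.NumberTheory.Automorphic Literature.NumberTheory.Automorphic.HermitianLattice Literature.NumberTheory.Automorphic.UnitaryLatticeTree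

variable {K : Type*} [Field K] [Valued K ℤᵐ⁰]

/-- **RIGID-2, TRANSVECTION TYPE, in «unit-factor» form**: under the hypotheses of ★ `levelTwo_conj_cornerUnipotent_of_two_deep`, the local element `x` is
`K₀`-conjugate to `u · n(t₀)` with `u ≡ 1 (mod ϖ²)` — `k x k⁻¹ = u * n` with `(n : M₃) = n(t₀)`, `n, u ∈ U(σ,J₀)`, `k, k⁻¹, n, n⁻¹` integral.
[cite: Rogawski1990, §3.9 p. 32] [cite: Tits1979, §3.3.3, §3.5] -/
theorem exists_conj_eq_levelTwo_mul_cornerUnipotent_of_two_deep {σ : K →+* K} {ϖ : K} (hd : UnramifiedLocalConjDatum σ ϖ) (h2 : Valued.v (2 : K) = 1)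
    (hN : ∀ u : K, σ u = u → Valued.v u = 1 → ∃ z : K, Valued.v (z * σ z - u) < 1)
    {γ g x : GL (Fin 3) K} (hγU : γ ∈ unitaryGroupOfForm σ ((StdForm.antidiagonal 3).over K))
    (hγ2 : IsIntMatrix ((ϖ ^ 2)⁻¹ • ((γ : Matrix (Fin 3) (Fin 3) K) - 1)))
    (hgU : g ∈ unitaryGroupOfForm σ ((StdForm.antidiagonal 3).over K)) (hxg : x = g⁻¹ * γ * g) (hxint : IsIntMatrix (x : Matrix (Fin 3) (Fin 3) K))
    (hx1 : ¬ IsIntMatrix (ϖ⁻¹ • ((x : Matrix (Fin 3) (Fin 3) K) - 1))) (hx2 : IsIntMatrix (ϖ⁻¹ • ((x : Matrix (Fin 3) (Fin 3) K) - 1) ^ 2))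
    {t₀ : K} (ht₀ : σ t₀ + t₀ = 0) (ht₀v : Valued.v t₀ = 1) :
    ∃ k n u : GL (Fin 3) K, k ∈ unitaryGroupOfForm σ ((StdForm.antidiagonal 3).over K) ∧ IsIntMatrix (k : Matrix (Fin 3) (Fin 3) K) ∧
      IsIntMatrix ((k⁻¹ : GL (Fin 3) K) : Matrix (Fin 3) (Fin 3) K) ∧
      (n : Matrix (Fin 3) (Fin 3) K) = !![1, 0, t₀; 0, 1, 0; 0, 0, 1] ∧ n ∈ unitaryGroupOfForm σ ((StdForm.antidiagonal 3).over K) ∧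
      IsIntMatrix (n : Matrix (Fin 3) (Fin 3) K) ∧ IsIntMatrix ((n⁻¹ : GL (Fin 3) K) : Matrix (Fin 3) (Fin 3) K) ∧
      u ∈ unitaryGroupOfForm σ ((StdForm.antidiagonal 3).over K) ∧
      IsIntMatrix ((ϖ ^ 2)⁻¹ • ((u : Matrix (Fin 3) (Fin 3) K) - 1)) ∧ k * x * k⁻¹ = u * n := by
  obtain ⟨k, hkU, hki, hki', hk⟩ := levelTwo_conj_cornerUnipotent_of_two_deep hd h2 hN hγU hγ2 hgU hxg hxint hx1 hx2 ht₀ ht₀v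
  obtain ⟨n, hn, hn'⟩ := exists_units_coe_eq_cornerUnipotent (K := K) t₀
  have hnU : n ∈ unitaryGroupOfForm σ ((StdForm.antidiagonal 3).over K) := (mem_unitaryGroupOfForm_iff_of_coe_eq_cornerUnipotent σ hn).2 ht₀
  have hni : IsIntMatrix (n : Matrix (Fin 3) (Fin 3) K) := by
    rw [hn]; intro i j; fin_cases i <;> fin_cases j <;> simp [ht₀v.le]
  have hni' : IsIntMatrix ((n⁻¹ : GL (Fin 3) K) : Matrix (Fin 3) (Fin 3) K) := by
    rw [hn']; intro i j; fin_cases i <;> fin_cases j <;> simp [ht₀v.le]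
  have hxU : x ∈ unitaryGroupOfForm σ ((StdForm.antidiagonal 3).over K) := by
    rw [hxg]; exact mul_mem (mul_mem (inv_mem hgU) hγU) hgU
  refine ⟨k, n, k * x * k⁻¹ * n⁻¹, hkU, hki, hki', hn, hnU, hni, hni', ?_, ?_, ?_⟩
  · exact mul_mem (mul_mem (mul_mem hkU hxU) (inv_mem hkU)) (inv_mem hnU)
  · rw [← hn] at hk
    exact isIntMatrix_smul_mul_inv_sub_one ((ϖ ^ 2)⁻¹) hni' hk
  · rw [inv_mul_cancel_right]

/-- **RIGID-2, REGULAR TYPE, in «unit-factor» form**: `k x k⁻¹ = u * m` with `(m : M₃) = u(1, b₀)`, `u ≡ 1 (mod ϖ²)`. [cite: Rogawski1990, §3.9 Prop. 3.9.1 p. 32] [cite: Tits1979, §3.3.3, §3.5] -/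
theorem exists_conj_eq_levelTwo_mul_upperUnipotent_one_of_two_deep {σ : K →+* K} {ϖ : K} (hd : UnramifiedLocalConjDatum σ ϖ) (h2 : Valued.v (2 : K) = 1)
    {γ g x : GL (Fin 3) K} (hγU : γ ∈ unitaryGroupOfForm σ ((StdForm.antidiagonal 3).over K))
    (hγ2 : IsIntMatrix ((ϖ ^ 2)⁻¹ • ((γ : Matrix (Fin 3) (Fin 3) K) - 1)))
    (hgU : g ∈ unitaryGroupOfForm σ ((StdForm.antidiagonal 3).over K)) (hxg : x = g⁻¹ * γ * g) (hxint : IsIntMatrix (x : Matrix (Fin 3) (Fin 3) K))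
    (hxreg : ¬ IsIntMatrix (ϖ⁻¹ • ((x : Matrix (Fin 3) (Fin 3) K) - 1) ^ 2))
    {b₀ : K} (hb₀ : b₀ + σ b₀ + 1 = 0) (hb₀v : Valued.v b₀ ≤ 1) :
    ∃ k m u : GL (Fin 3) K, k ∈ unitaryGroupOfForm σ ((StdForm.antidiagonal 3).over K) ∧ IsIntMatrix (k : Matrix (Fin 3) (Fin 3) K) ∧
      IsIntMatrix ((k⁻¹ : GL (Fin 3) K) : Matrix (Fin 3) (Fin 3) K) ∧
      (m : Matrix (Fin 3) (Fin 3) K) = !![1, 1, b₀; 0, 1, -1; 0, 0, 1] ∧ m ∈ unitaryGroupOfForm σ ((StdForm.antidiagonal 3).over K) ∧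
      IsIntMatrix (m : Matrix (Fin 3) (Fin 3) K) ∧ IsIntMatrix ((m⁻¹ : GL (Fin 3) K) : Matrix (Fin 3) (Fin 3) K) ∧
      u ∈ unitaryGroupOfForm σ ((StdForm.antidiagonal 3).over K) ∧
      IsIntMatrix ((ϖ ^ 2)⁻¹ • ((u : Matrix (Fin 3) (Fin 3) K) - 1)) ∧ k * x * k⁻¹ = u * m := by
  obtain ⟨k, hkU, hki, hki', hk⟩ := levelTwo_conj_upperUnipotent_one_of_two_deep hd h2 hγU hγ2 hgU hxg hxint hxreg hb₀ hb₀v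
  obtain ⟨m, hm, hm'⟩ := exists_units_coe_eq_upperTriangularUnipotent (1 : K) b₀ (-1)
  have hmU : m ∈ unitaryGroupOfForm σ ((StdForm.antidiagonal 3).over K) := by
    refine (mem_unitaryGroupOfForm_iff_of_coe_eq_upperUnipotent σ hd.σσ hm).2 ⟨by rw [map_one], ?_⟩
    rw [map_one, mul_one]; exact hb₀
  have h1v : Valued.v (1 : K) ≤ 1 := by rw [map_one]
  have hn1v : Valued.v (-1 : K) ≤ 1 := by rw [Valuation.map_neg, map_one]
  have hmi : IsIntMatrix (m : Matrix (Fin 3) (Fin 3) K) := by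
    rw [hm]; exact isIntMatrix_upperUnipotent h1v hb₀v hn1v
  have hmi' : IsIntMatrix ((m⁻¹ : GL (Fin 3) K) : Matrix (Fin 3) (Fin 3) K) := by
    rw [hm']
    refine isIntMatrix_upperUnipotent hn1v ?_ (by rw [neg_neg, map_one])
    calc Valued.v ((1 : K) * -1 - b₀) = Valued.v (-(1 + b₀)) := by ring_nf
      _ ≤ 1 := by rw [Valuation.map_neg]; exact Valuation.map_add_le _ h1v hb₀v
  have hxU : x ∈ unitaryGroupOfForm σ ((StdForm.antidiagonal 3).over K) := by
    rw [hxg]; exact mul_mem (mul_mem (inv_mem hgU) hγU) hgU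
  refine ⟨k, m, k * x * k⁻¹ * m⁻¹, hkU, hki, hki', hm, hmU, hmi, hmi', ?_, ?_, ?_⟩
  · exact mul_mem (mul_mem (mul_mem hkU hxU) (inv_mem hkU)) (inv_mem hmU)
  · rw [← hm] at hk
    exact isIntMatrix_smul_mul_inv_sub_one ((ϖ ^ 2)⁻¹) hmi' hk
  · rw [inv_mul_cancel_right]

end Literature.NumberTheory.Automorphic.UnitaryGroup

end
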